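import Mathlib
import Literature.Computability.AlgebraicComplexity.Apolarity
import Literature.Computability.AlgebraicComplexity.ApolarityAction
import Literature.Computability.AlgebraicComplexity.ApolarityTopPairing
import Literature.Computability.AlgebraicComplexity.LinSubst
import Summits.ValiantsHypothesis.ValiantsHypothesis.Theorems.BorderApolarityFixedWitnessObstructionQPAnnSubmodule

/-!
# Border apolarity, crux `ToricWitnessObstructionQP` (stmt-ValiantsHypothesis-14753),
# line `Sketch`, reshape 4: helper stub `snf_shadow_feeding` (shadow feeding)

Route `ValiantsHypothesis/BorderApolarity`, crux item `stmt-ValiantsHypothesis-14753`,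
line `Sketch`, reshape 4 (structure of stable normal forms), wave-4 helper
`snf_shadow_feeding`.

The residual of the line records Hom-stability of a space `J` of degree-`k` operator forms
under all transvections `X u ↦ X u + c • X z` with `u` an OWN variable (`ess u`) and `z` an
UNUSED one (`¬ ess z`).  SHADOW FEEDING: if `J` contains a nonzero PURE-OWN form `f` (no unused
variable occurs in its support), then `J` contains every pure-unused monomial `x ^ d` of
degree `k`.

Proof.  By the polarisation lemma `snf_X_mul_pderiv_mem` of the sibling file
`BorderApolarityToricWitnessObstructionQPPolarisation.lean` (re-checked here under private
`snfsh_pol_` names, so that this file does not depend on that one), `J` is stable under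
`g ↦ X z * ∂_u g` for all own `u` and unused `z`.  Iterating along a list `lu` of own and a
list `lz` of unused variables of equal length gives `(∏ X lz) * ((∏ X lu) ⌟ f) ∈ J`
(`snfsh_iter_mem`: the variables of `lz` are constants for `∂_u`, and
`(X u * D) ⌟ f = ∂_u (D ⌟ f)`).  Choosing `lu` realising a support monomial `x ^ e` of `f`
(all its variables are own since `f` is pure-own) and `lz` realising `x ^ d` (all unused), the
top-degree pairing `x ^ e ⌟ f = C (f_e · e!)` (`BorderApolarity.apolarAction_eq_C`) is a
nonzero scalar, whence `x ^ d ∈ J`.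
-/

open MvPolynomial Filter
open scoped BigOperators Matrix
open Literature.Computability.AlgebraicComplexity

set_option linter.dupNamespace false

namespace Summit.ValiantsHypothesis.ValiantsHypothesis.Theorems.BorderApolarityToricWitnessObstructionQP

section Transvection

variable {σ : Type} [Fintype σ] [DecidableEq σ]

/-- The transvection `1 + c • E_{z u}` acts on variables by
`X i ↦ X i + [i = u] • c • X z`. [folklore] -/
private theorem snfsh_pol_transvection_X (u z : σ) (c : ℂ) (i : σ) :
    linSubst σ ℂ (1 + c • Matrix.single z u (1 : ℂ)) (X i) =
      X i + if i = u then c • X z else 0 := by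
  rw [linSubst_X]
  simp only [Matrix.add_apply, Matrix.one_apply, Matrix.smul_apply, Matrix.single_apply,
    smul_eq_mul, mul_ite, mul_one, mul_zero, add_smul, Finset.sum_add_distrib, ite_smul,
    one_smul, zero_smul, Finset.sum_ite_eq', Finset.mem_univ, if_true, ite_and,
    Finset.sum_ite_eq]
  congr 1
  by_cases h : i = u
  · simp [h]
  · simp [h, Ne.symm h]

/-- The generating polynomial `P_f(t) := f(X_u + t X_z)` evaluates at `t = c` to the transvection
`T_c f`. [folklore] -/
private theorem snfsh_pol_eval_genPoly (u z : σ) (c : ℂ) (f : MvPolynomial σ ℂ) :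
    (aeval (fun i : σ => Polynomial.C (X i : MvPolynomial σ ℂ) +
        if i = u then Polynomial.X * Polynomial.C (X z : MvPolynomial σ ℂ) else 0) f).eval
        (C c) = linSubst σ ℂ (1 + c • Matrix.single z u (1 : ℂ)) f := by
  induction f using MvPolynomial.induction_on with
  | C a =>
    rw [linSubst_C, aeval_C, Polynomial.algebraMap_apply, Polynomial.eval_C, algebraMap_eq]
  | add p q hp hq => rw [map_add, Polynomial.eval_add, hp, hq, map_add]
  | mul_X p i hp =>
    rw [map_mul, Polynomial.eval_mul, hp, map_mul, aeval_X, snfsh_pol_transvection_X]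
    split_ifs
    · rw [Polynomial.eval_add, Polynomial.eval_C, Polynomial.eval_mul, Polynomial.eval_X,
        Polynomial.eval_C, smul_eq_C_mul]
    · rw [add_zero, add_zero, Polynomial.eval_C]

/-- The constant coefficient of the generating polynomial `P_f` is `f`. [folklore] -/
private theorem snfsh_pol_coeff_zero_genPoly (u z : σ) (f : MvPolynomial σ ℂ) :
    (aeval (fun i : σ => Polynomial.C (X i : MvPolynomial σ ℂ) +
        if i = u then Polynomial.X * Polynomial.C (X z : MvPolynomial σ ℂ) else 0) f).coeff 0 =
      f := by
  rw [Polynomial.coeff_zero_eq_eval_zero, ← C_0, snfsh_pol_eval_genPoly, zero_smul, add_zero,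
    linSubst_one, AlgHom.id_apply]

/-- The coefficient of `t` in the generating polynomial `P_f` is the polarisation `X z * ∂_u f`.
[folklore] -/
private theorem snfsh_pol_coeff_one_genPoly (u z : σ) (f : MvPolynomial σ ℂ) :
    (aeval (fun i : σ => Polynomial.C (X i : MvPolynomial σ ℂ) +
        if i = u then Polynomial.X * Polynomial.C (X z : MvPolynomial σ ℂ) else 0) f).coeff 1 =
      X z * pderiv u f := by
  induction f using MvPolynomial.induction_on with
  | C a =>
    rw [aeval_C, Polynomial.algebraMap_apply, Polynomial.coeff_C, if_neg one_ne_zero, pderiv_C,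
      mul_zero]
  | add p q hp hq => rw [map_add, Polynomial.coeff_add, hp, hq, map_add, mul_add]
  | mul_X p i hp =>
    have h0 := snfsh_pol_coeff_zero_genPoly u z p
    rw [map_mul, aeval_X, pderiv_mul]
    split_ifs with hi
    · subst hi
      rw [mul_add, Polynomial.coeff_add, Polynomial.coeff_mul_C, hp, ← mul_assoc,
        Polynomial.coeff_mul_C, Polynomial.coeff_mul_X, h0, pderiv_X_self]
      ring
    · rw [add_zero, Polynomial.coeff_mul_C, hp, pderiv_X_of_ne hi]
      ring

/-- **Transvection expansion**: for every `f` there are `R` and coefficients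
`F 0 = f`, `F 1 = X z * ∂_u f`, `F j = 0` for `j > R`, with
`T_c f = ∑_{j ≤ R} c ^ j • F j` for all `c`. [folklore] -/
private theorem snfsh_pol_transvection_expansion (u z : σ) (f : MvPolynomial σ ℂ) :
    ∃ (R : ℕ) (F : ℕ → MvPolynomial σ ℂ), F 0 = f ∧ F 1 = X z * pderiv u f ∧
      (∀ j, R < j → F j = 0) ∧
      ∀ c : ℂ, linSubst σ ℂ (1 + c • Matrix.single z u (1 : ℂ)) f =
        ∑ j ∈ Finset.range (R + 1), c ^ j • F j := by
  set P : Polynomial (MvPolynomial σ ℂ) :=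
    aeval (fun i : σ => Polynomial.C (X i : MvPolynomial σ ℂ) +
      if i = u then Polynomial.X * Polynomial.C (X z : MvPolynomial σ ℂ) else 0) f
  refine ⟨P.natDegree, fun j => P.coeff j, snfsh_pol_coeff_zero_genPoly u z f,
    snfsh_pol_coeff_one_genPoly u z f,
    fun j hj => Polynomial.coeff_eq_zero_of_natDegree_lt hj, ?_⟩
  intro c
  rw [← snfsh_pol_eval_genPoly u z c f, Polynomial.eval_eq_sum_range]
  refine Finset.sum_congr rfl fun j _ => ?_
  rw [← C_pow, mul_comm, C_mul']

end Transvection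

section Vandermonde

variable {V : Type*} [AddCommGroup V] [Module ℂ V]

/-- **Vandermonde extraction**: if the values of `c ↦ ∑_{j ≤ R} c ^ j • F j` lie in a
subspace `J` for all scalars `c`, then so does every coefficient `F j`, `j ≤ R`. [folklore] -/
private theorem snfsh_pol_vandermonde_mem (J : Submodule ℂ V) (R : ℕ) (F : ℕ → V)
    (h : ∀ c : ℂ, (∑ j ∈ Finset.range (R + 1), c ^ j • F j) ∈ J) :
    ∀ j ∈ Finset.range (R + 1), F j ∈ J := by
  intro j hj
  -- nodes `0, 1, …, R` and the Vandermonde matrix `M i l = i ^ l`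
  set v : Fin (R + 1) → ℂ := fun i => ((i : ℕ) : ℂ)
  set M : Matrix (Fin (R + 1)) (Fin (R + 1)) ℂ := Matrix.vandermonde v with hM
  have hdet : IsUnit M.det := by
    rw [isUnit_iff_ne_zero, hM, Matrix.det_vandermonde_ne_zero_iff]
    intro a b hab
    exact Fin.ext (Nat.cast_injective (R := ℂ) hab)
  have hval : ∀ i : Fin (R + 1), (∑ l : Fin (R + 1), M i l • F l) ∈ J := by
    intro i
    have := h (v i)
    rw [Finset.sum_range (fun l => v i ^ l • F l)] at this
    simpa [hM, Matrix.vandermonde_apply] using this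
  -- invert: `F j = ∑ i, M⁻¹ j i • (∑ l, M i l • F l)`, a combination of members of `J`
  have hcalc : (∑ i : Fin (R + 1), M⁻¹ ⟨j, Finset.mem_range.mp hj⟩ i •
      ∑ l : Fin (R + 1), M i l • F l) = F j := by
    simp_rw [Finset.smul_sum, smul_smul]
    rw [Finset.sum_comm]
    simp_rw [← Finset.sum_smul, ← Matrix.mul_apply, Matrix.nonsing_inv_mul _ hdet,
      Matrix.one_apply, ite_smul, one_smul, zero_smul, Finset.sum_ite_eq, Finset.mem_univ,
      if_true]
  rw [← hcalc]
  exact Submodule.sum_mem _ fun i _ => Submodule.smul_mem _ _ (hval i)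

end Vandermonde

/-- **Polarisation preserves transvection-stable subspaces**: a `ℂ`-subspace of polynomials
stable under all transvections `X u ↦ X u + c • X z` is stable under `f ↦ X z * ∂_u f`.
[folklore] -/
private theorem snfsh_pol_X_mul_pderiv_mem {σ : Type} [Fintype σ] [DecidableEq σ]
    (J : Submodule ℂ (MvPolynomial σ ℂ)) (u z : σ)
    (hJ : ∀ c : ℂ, ∀ f ∈ J, linSubst σ ℂ (1 + c • Matrix.single z u (1 : ℂ)) f ∈ J) :
    ∀ f ∈ J, X z * pderiv u f ∈ J := by
  intro f hf
  obtain ⟨R, F, -, hF1, hFR, hT⟩ := snfsh_pol_transvection_expansion u z f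
  have hsum : ∀ c : ℂ, (∑ j ∈ Finset.range (R + 1), c ^ j • F j) ∈ J := fun c =>
    hT c ▸ hJ c f hf
  rw [← hF1]
  by_cases hR : 1 < R + 1
  · exact snfsh_pol_vandermonde_mem J R F hsum 1 (Finset.mem_range.mpr hR)
  · rw [hFR 1 (by omega)]
    exact Submodule.zero_mem J

section ShadowFeeding

variable {σ : Type*}

/-- A product of variables all different from `u` is a constant for `∂_u`. [folklore] -/
theorem snfsh_pderiv_prod_X_eq_zero (u : σ) (lz : List σ) (h : ∀ z ∈ lz, z ≠ u) :
    pderiv u ((lz.map X).prod : MvPolynomial σ ℂ) = 0 := by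
  induction lz with
  | nil => rw [List.map_nil, List.prod_nil, pderiv_one]
  | cons z lz ih =>
    rw [List.map_cons, List.prod_cons, pderiv_mul,
      ih fun z' hz' => h z' (List.mem_cons_of_mem z hz'),
      pderiv_X_of_ne (h z List.mem_cons_self), zero_mul, mul_zero, add_zero]

/-- **Iterated polarisation.**  If `J` is stable under `g ↦ X z * ∂_u g` for all own `u` and
unused `z`, then for a list `lu` of own and a list `lz` of unused variables of equal length and
`f ∈ J`, `(∏ X lz) * ((∏ X lu) ⌟ f) ∈ J`. [folklore] -/
theorem snfsh_iter_mem (ess : σ → Prop) (J : Submodule ℂ (MvPolynomial σ ℂ))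
    (hJ : ∀ u z : σ, ess u → ¬ ess z → ∀ g ∈ J, X z * pderiv u g ∈ J)
    (f : MvPolynomial σ ℂ) (hf : f ∈ J) :
    ∀ lu lz : List σ, lu.length = lz.length → (∀ u ∈ lu, ess u) → (∀ z ∈ lz, ¬ ess z) →
      (lz.map X).prod * apolarAction (lu.map X).prod f ∈ J := by
  intro lu
  induction lu with
  | nil =>
    intro lz hlen _ _
    obtain rfl : lz = [] := List.eq_nil_of_length_eq_zero hlen.symm
    rw [List.map_nil, List.prod_nil, one_mul, ← C_1, apolarAction_C, one_smul]
    exact hf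
  | cons u lu ih =>
    intro lz hlen hu hz
    cases lz with
    | nil => exact absurd hlen (by simp)
    | cons z lz =>
      have hu0 : ess u := hu u List.mem_cons_self
      have hz0 : ¬ ess z := hz z List.mem_cons_self
      have hne : ∀ z' ∈ lz, z' ≠ u := by
        intro z' hz' h
        subst h
        exact hz z' (List.mem_cons_of_mem z hz') hu0
      have hg : (lz.map X).prod * apolarAction (lu.map X).prod f ∈ J :=
        ih lz (by simpa using hlen) (fun u' hu' => hu u' (List.mem_cons_of_mem u hu'))
          (fun z' hz' => hz z' (List.mem_cons_of_mem z hz'))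
      have key : X z * pderiv u ((lz.map X).prod * apolarAction (lu.map X).prod f) =
          ((z :: lz).map X).prod * apolarAction ((u :: lu).map X).prod f := by
        rw [pderiv_mul, snfsh_pderiv_prod_X_eq_zero u lz hne, zero_mul, zero_add,
          List.map_cons, List.prod_cons, List.map_cons, List.prod_cons, apolarAction_X_mul,
          apolarAction_X, mul_assoc]
      rw [← key]
      exact hJ u z hu0 hz0 _ hg

/-- Every monic monomial `x ^ d` is a product of `|d|` variables taken from the support of `d`.
[folklore] -/
theorem snfsh_exists_prod_X_eq_monomial (d : σ →₀ ℕ) :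
    ∃ l : List σ, l.length = d.degree ∧ (∀ i ∈ l, i ∈ d.support) ∧
      (l.map X).prod = monomial d (1 : ℂ) := by
  induction d using Finsupp.induction with
  | zero => exact ⟨[], by simp, fun i hi => by simp at hi, by simp⟩
  | single_add a b f ha hb ih =>
    obtain ⟨l, hl, hmem, hprod⟩ := ih
    refine ⟨List.replicate b a ++ l, ?_, ?_, ?_⟩
    · rw [List.length_append, List.length_replicate, hl, map_add, Finsupp.degree_single]
    · intro i hi
      rw [Finsupp.support_single_add ha hb, Finset.mem_cons]
      rw [List.mem_append, List.mem_replicate] at hi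
      rcases hi with ⟨-, h⟩ | hi
      · exact Or.inl h
      · exact Or.inr (hmem i hi)
    · rw [List.map_append, List.prod_append, List.map_replicate, List.prod_replicate, hprod,
        X_pow_eq_monomial, monomial_mul, one_mul]

end ShadowFeeding

/-- W4a SHADOW FEEDING: in a transvection-stable space of degree-`k` forms, a nonzero PURE-OWN
element forces every pure-unused monomial of degree `k` into the space. [folklore] -/
theorem snf_shadow_feeding : ∀ {σ : Type} [Fintype σ] [DecidableEq σ] (ess : σ → Prop)
    [DecidablePred ess] (J : Submodule ℂ (MvPolynomial σ ℂ)) (k : ℕ),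
    (∀ u z : σ, ess u → ¬ ess z → ∀ c : ℂ, ∀ f ∈ J,
      linSubst σ ℂ (1 + c • Matrix.single z u (1 : ℂ)) f ∈ J) →
    ∀ f ∈ J, f ≠ 0 → f.IsHomogeneous k → (∀ d ∈ f.support, ∀ i, ¬ ess i → d i = 0) →
    ∀ d : σ →₀ ℕ, d.degree = k → (∀ i, ess i → d i = 0) → monomial d (1 : ℂ) ∈ J := by
  intro σ _ _ ess _ J k hJ f hf hf0 hfk hown d hd hunused
  -- polarisation stability of `J`
  have hP : ∀ u z : σ, ess u → ¬ ess z → ∀ g ∈ J, X z * pderiv u g ∈ J :=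
    fun u z hu hz => snfsh_pol_X_mul_pderiv_mem J u z (hJ u z hu hz)
  -- a support exponent `e` of `f`: pure-own, of degree `k`
  obtain ⟨e, he⟩ := ne_zero_iff.1 hf0
  have he' : e ∈ f.support := mem_support_iff.2 he
  have hedeg : e.degree = k := by
    rw [Finsupp.degree_eq_weight_one]
    exact hfk he
  obtain ⟨lu, hlu, hlumem, hluprod⟩ := snfsh_exists_prod_X_eq_monomial (σ := σ) e
  obtain ⟨lz, hlz, hlzmem, hlzprod⟩ := snfsh_exists_prod_X_eq_monomial (σ := σ) d
  have hmem := snfsh_iter_mem ess J hP f hf lu lz (by rw [hlu, hlz, hedeg, hd])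
    (fun u hu => by
      by_contra h
      exact Finsupp.mem_support_iff.1 (hlumem u hu) (hown e he' u h))
    (fun z hz h => Finsupp.mem_support_iff.1 (hlzmem z hz) (hunused z h))
  rw [hluprod, hlzprod] at hmem
  -- the top-degree pairing `x ^ e ⌟ f` is the nonzero scalar `f_e · e!`
  have hC : apolarAction (monomial e (1 : ℂ)) f =
      C (coeff e f * ∏ i ∈ e.support, ((e i).factorial : ℂ)) := by
    rw [BorderApolarity.apolarAction_eq_C (isHomogeneous_monomial _ hedeg) hfk,
      support_monomial, if_neg one_ne_zero, Finset.sum_singleton, coeff_monomial, if_pos rfl,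
      one_mul]
  have ha0 : coeff e f * ∏ i ∈ e.support, ((e i).factorial : ℂ) ≠ 0 :=
    mul_ne_zero he (BorderApolarity.prod_factorial_ne_zero e)
  have key : monomial d (1 : ℂ) = (coeff e f * ∏ i ∈ e.support, ((e i).factorial : ℂ))⁻¹ •
      (monomial d (1 : ℂ) * apolarAction (monomial e (1 : ℂ)) f) := by
    rw [hC, mul_comm (monomial d (1 : ℂ)) _, ← smul_eq_C_mul, smul_smul, inv_mul_cancel₀ ha0,
      one_smul]
  rw [key]
  exact J.smul_mem _ hmem

end Summit.ValiantsHypothesis.ValiantsHypothesis.Theorems.BorderApolarityToricWitnessObstructionQP
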